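/-
Copyright (c) 2026 the pub-hodgecm-mathlib formalisation cell (harness21).  Prover seat hodgecm-mathlib-A-p03 (g26); road «W′ = R1LL-WILD», sub-socket (B6-O) of F0P3-p01 (g14)'s
(W′-B6) map (12:05Z); architect A-p16 (g28) RULINGS A-32∕A-37∕A-44; convention F0P3-p01 12:21Z, 2026-09-01.
-/
import Literature.NumberTheory.Rogawski1990.RankOneTorusHilbertSymbolLocalConstancy        -- ★ p844089 (this seat): `hilbertSymbol_eq_one_of_valued_toPlace_sub_four_lt`; brings ★ B-p12 p844015 (`bc`, bilinearity)
import Literature.NumberTheory.Rogawski1990.KottwitzSignTwistedFrame                      -- ★ `exists_mul_conjLocal_eq_toLocalRing_iff` (local norm dictionary)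
import Literature.NumberTheory.QuadraticForms.QuadraticNormIndex                          -- ★ `hilbertSymbol_eq_one_iff_mem_quadraticNormSubgroup`
import Literature.NumberTheory.Automorphic.ProjectiveDescentLatticeLevelsDischarge          -- ★ `valued_toPlace_eq_pow_two_of_ramified`
import Literature.NumberTheory.Rogawski1990.ExplicitFactorKappaAlmostEverywhereOne           -- ★ `conjLocal_apply_eq_galAdicCompletionMap`
import Literature.NumberTheory.Automorphic.UnitaryGroupInertPlaceHyperbolicBasis            -- ★ `exists_toPlace_eq_of_galAdicCompletionMap_eq`, `galAdicCompletionMap_galAdicCompletionMap_of_smul_eq`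
import Literature.NumberTheory.Automorphic.SelfDualLatticeCountFrameTransportCM             -- ★ `galAdicCompletionMap_toPlace_self`
import HarnessLib

/-!
# (W′-B6)∕(B6-O) THE DEPTH AND SIGN DICTIONARIES between the canonical torus coordinate `bc` (★ B-p12 p844015: `ι_w bc = (z − z⁻¹)∕η`, `z = τ₀∕τ₁`)
# and the Eisenstein WINDOW coordinate `b` (B-p04 (g35) ∕ B-p14 (g33) normal form `G = s • ι(1 + b·M_τ)`: `τ₀ = s(1 + ι b·τ_E)`, `τ₁ = s(1 + ι b·σ_w τ_E)`)
# (Labesse–Langlands 1979 §2 (2.1)–(2.2); Labesse 2024 Prop. 0.0.11, Th. 0.0.12)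

Topic `NumberTheory/Rogawski1990`; namespace `Literature.NumberTheory.Rogawski1990`.  THEOREMS ONLY (no definition, no instance, no notation, no named fact, no `sorry`).
Cell `pub/hodgecm-mathlib` (D-0151), crux H413 = `stmt-HodgeConjecture-24833`, road «W′ = R1LL-WILD», residue `RankOneUnstableTransferNonsplitCMERamifiedWild`; consumer =
★ F0P3-p01 p844200 `exists_wildLaw_torus_of_shellLaws`, binders `(k₀ c₀ hoT hκT)`: `hoT : |ι_w ↑(bc t)|_w = exp(−(2·oT t + k₀))`, `hκT : κT t = ((↑(bc t)·↑c₀, θ)_v : ℂ)`,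
under the (B6-V) convention of record (F0P3-p01 12:21Z): `oT t := ord_v (b t)`, `κT t := ((b t, θ)_v : ℂ)`.  HONEST LABEL: HC_CM is proved only modulo the printed citations
(hLiu418, h413) until rung 0 closes; this file is field algebra + valuations + Hilbert-symbol bookkeeping and asserts nothing printed.

THE ALGEBRA (any field): with `γ := 1 + b·τ`, `γ′ := 1 + b·τ′`, `z := sγ∕sγ′`:  **`z − z⁻¹ = b·(τ − τ′)·(2 + b·(τ + τ′)) ∕ (γ·γ′)`** (§1).  At the place (`τ′ = σ_w τ_E`,
`τ + τ′ = ι u₀`, `η`, `τ − τ′` skew): `ι bc = ι b · c · (2 + ι b·ι u₀) ∕ N`, `c := (τ_E − σ τ_E)∕η ∈ ι(L⁺_v)^×`, `N := γ·σγ` a NORM.  On the deep locus (`|ι b·τ_E|, |ι b·στ_E| < 1`,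
`|ι b·u₀| < |2|`): **`|ι bc|_w = |ι b|_w · |2c|_w`** (§2, the DEPTH dictionary — `e(w|v) = 2` turns `|ι b| = |b|_v²` into the fold's `exp(−(2·oT + k₀))`), and with
`ι c₀ := 2c`: **`(bc·c₀, θ)_v = (b, θ)_v`** (§3, the SIGN dictionary — squares drop, `(4 + 2 b u₀, θ)_v = 1` by ★ p844089 `hilbertSymbol_eq_one_of_valued_toPlace_sub_four_lt`
since `|2 ι b u₀| < |16|`, and `(N, θ)_v = 1` for the norm `N` by ★ `exists_mul_conjLocal_eq_toLocalRing_iff` + ★ `hilbertSymbol_eq_one_iff_mem_quadraticNormSubgroup`).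
Dyadic places included throughout (no `2 ∤ v`); the LABELLED identification `τ₀ ↔ τ_E`, `τ₁ ↔ σ τ_E` is a hypothesis (`hlab`; WLOG at `t₀` by `τ_E ↦ σ τ_E`, (B6-H)∕(B6-P)).

## References
* [LabesseLanglands1979] J.-P. Labesse, R. P. Langlands, *L-indistinguishability for SL(2)*, Canad. J. Math. 31 (1979): §2 (2.1)–(2.2) pp. 7–9.
* [Labesse2024StabilisationGermesSL2] J.-P. Labesse, *Stabilisation et germes pour SL(2)* (arXiv:2411.14820): Prop. 0.0.11, Th. 0.0.12 pp. 7–8 (`κ(c₂) = κ(det x̃)·κ(b)`).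
* [Rogawski1990] J. D. Rogawski, *Automorphic Representations of Unitary Groups in Three Variables* (1990): §4.9 Lemma 4.9.3 p. 56.
* [Omeara1963] O. T. O'Meara, *Introduction to Quadratic Forms* (1963): §63A–B.
-/

set_option autoImplicit false

noncomputable section

open NumberField IsDedekindDomain Filter Topology

namespace Literature.NumberTheory.Rogawski1990

open Literature.NumberTheory.Automorphic Literature.NumberTheory.Automorphic.UnitaryGroup Literature.NumberTheory.GaloisRepresentations
  Literature.NumberTheory.QuadraticForms

/-! ## §1 Field algebra: `z − z⁻¹` in Eisenstein coordinates -/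

section Algebra

variable {K : Type*} [Field K]

/-- **`z − z⁻¹` IN EISENSTEIN COORDINATES**: for `z = sγ∕(sγ′)`, `γ = 1 + bτ`, `γ′ = 1 + bτ′` (all non-zero):
`z − z⁻¹ = b(τ − τ′)(2 + b(τ + τ′)) ∕ (γγ′)`. [cite: LabesseLanglands1979, §2 (2.1)] [cite: Labesse2024StabilisationGermesSL2, Prop. 0.0.11] -/
theorem div_sub_div_eq_eisenstein {s b τ τ' : K} (hs : s ≠ 0) (hγ : 1 + b * τ ≠ 0) (hγ' : 1 + b * τ' ≠ 0) :
    s * (1 + b * τ) / (s * (1 + b * τ')) - s * (1 + b * τ') / (s * (1 + b * τ)) =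
      b * (τ - τ') * (2 + b * (τ + τ')) / ((1 + b * τ) * (1 + b * τ')) := by
  field_simp
  ring

/-- The difference of the two eigenvalues: `sγ − sγ′ = s·b·(τ − τ′)`. [cite: LabesseLanglands1979, §2 (2.1)] -/
theorem mul_one_add_sub_mul_one_add (s b τ τ' : K) : s * (1 + b * τ) - s * (1 + b * τ') = s * b * (τ - τ') := by ring

/-- The norm form in Eisenstein coordinates: `(1 + bτ)(1 + bτ′) = 1 + b(τ + τ′) + b²(ττ′)`. [cite: LabesseLanglands1979, §2 (2.1)] -/
theorem one_add_mul_one_add_eq (b τ τ' : K) : (1 + b * τ) * (1 + b * τ') = 1 + b * (τ + τ') + b ^ 2 * (τ * τ') := by ring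

end Algebra

/-! ## §2 At the place `w ∣ v`: the DEPTH dictionary `|ι bc|_w = |ι b|_w · |2c|_w` -/

section Place

variable (L : Type) [Field L] [NumberField L] [IsCMField L] (v : HeightOneSpectrum (𝓞 ↥(maximalRealSubfield L)))
  (w : PlacesOver L v) (hw : IsCMField.complexConj L • w.1 = w.1)

omit [IsCMField L] in
/-- **`ι_w bc` IN EISENSTEIN COORDINATES**: if the frame eigenvalues are `x₀ = s(1 + ι b·τ)`, `x₁ = s(1 + ι b·τ′)` and `ι bc = (x₀∕x₁ − x₁∕x₀)∕η`, then
`ι bc = ι b·(τ − τ′)·(2 + ι b·(τ + τ′)) ∕ ((1 + ι b τ)(1 + ι b τ′)·η)`. [cite: LabesseLanglands1979, §2 (2.1)] [cite: Labesse2024StabilisationGermesSL2, Prop. 0.0.11] -/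
theorem toPlace_bcoord_eq_eisenstein {x₀ x₁ s τ τ' η : w.1.adicCompletion L} {b : v.adicCompletion ↥(maximalRealSubfield L)}
    {bc : (v.adicCompletion ↥(maximalRealSubfield L))ˣ} (hs : s ≠ 0) (hγ : 1 + toPlace v w b * τ ≠ 0) (hγ' : 1 + toPlace v w b * τ' ≠ 0)
    (hx₀ : x₀ = s * (1 + toPlace v w b * τ)) (hx₁ : x₁ = s * (1 + toPlace v w b * τ'))
    (hbc : toPlace v w (bc : v.adicCompletion ↥(maximalRealSubfield L)) = (x₀ / x₁ - x₁ / x₀) / η) :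
    toPlace v w (bc : v.adicCompletion ↥(maximalRealSubfield L)) =
      toPlace v w b * (τ - τ') * (2 + toPlace v w b * (τ + τ')) / ((1 + toPlace v w b * τ) * (1 + toPlace v w b * τ') * η) := by
  rw [hbc, hx₀, hx₁, div_sub_div_eq_eisenstein hs hγ hγ', div_div]

omit [IsCMField L] in
/-- Ultrametric bookkeeping: `|1 + y| = 1` for `|y| < 1`. [cite: Omeara1963, §63A] -/
theorem valued_one_add_eq_one {y : w.1.adicCompletion L} (hy : Valued.v y < 1) : Valued.v (1 + y) = 1 := by
  rw [Valuation.map_add_eq_of_lt_left _ (by rwa [Valuation.map_one]), Valuation.map_one]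

omit [IsCMField L] in
/-- Ultrametric bookkeeping: `|2 + y| = |2|` for `|y| < |2|`. [cite: Omeara1963, §63A] -/
theorem valued_two_add_eq {y : w.1.adicCompletion L} (hy : Valued.v y < Valued.v (2 : w.1.adicCompletion L)) :
    Valued.v (2 + y) = Valued.v (2 : w.1.adicCompletion L) := by
  rw [Valuation.map_add_eq_of_lt_left _ hy]

omit [IsCMField L] in
/-- **THE DEPTH DICTIONARY (valuation form)**: under the Eisenstein identification and on the deep locus (`|ι b·τ|, |ι b·τ′| < 1`, `|ι b·(τ + τ′)| < |2|`),
**`|ι_w bc|_w = |ι_w b|_w · |2(τ − τ′)∕η|_w`**. [cite: LabesseLanglands1979, §2 (2.2)] [cite: Labesse2024StabilisationGermesSL2, Th. 0.0.12] -/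
theorem valued_toPlace_bcoord_eq_eisenstein {x₀ x₁ s τ τ' η : w.1.adicCompletion L} {b : v.adicCompletion ↥(maximalRealSubfield L)}
    {bc : (v.adicCompletion ↥(maximalRealSubfield L))ˣ} (hs : s ≠ 0)
    (hx₀ : x₀ = s * (1 + toPlace v w b * τ)) (hx₁ : x₁ = s * (1 + toPlace v w b * τ'))
    (hbc : toPlace v w (bc : v.adicCompletion ↥(maximalRealSubfield L)) = (x₀ / x₁ - x₁ / x₀) / η)
    (hd₀ : Valued.v (toPlace v w b * τ) < 1) (hd₁ : Valued.v (toPlace v w b * τ') < 1)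
    (hd₂ : Valued.v (toPlace v w b * (τ + τ')) < Valued.v (2 : w.1.adicCompletion L)) :
    Valued.v (toPlace v w (bc : v.adicCompletion ↥(maximalRealSubfield L))) = Valued.v (toPlace v w b) * Valued.v (2 * (τ - τ') / η) := by
  have hγ1 : Valued.v (1 + toPlace v w b * τ) = 1 := valued_one_add_eq_one L v w hd₀
  have hγ1' : Valued.v (1 + toPlace v w b * τ') = 1 := valued_one_add_eq_one L v w hd₁
  have hγ : 1 + toPlace v w b * τ ≠ 0 := fun h0 => by rw [h0, map_zero] at hγ1; exact zero_ne_one hγ1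
  have hγ' : 1 + toPlace v w b * τ' ≠ 0 := fun h0 => by rw [h0, map_zero] at hγ1'; exact zero_ne_one hγ1'
  rw [toPlace_bcoord_eq_eisenstein L v w hs hγ hγ' hx₀ hx₁ hbc, map_div₀, map_div₀, map_mul, map_mul, map_mul, map_mul, map_mul, hγ1, hγ1', one_mul, one_mul,
    valued_two_add_eq L v w hd₂]
  simp only [div_eq_mul_inv, mul_assoc, mul_comm, mul_left_comm]

end Place

/-! ## §3 The SIGN dictionary `(bc·c₀, θ)_v = (b, θ)_v` -/

section Sign

variable (L : Type) [Field L] [NumberField L] [IsCMField L] (v : HeightOneSpectrum (𝓞 ↥(maximalRealSubfield L)))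
  (w : PlacesOver L v) (hw : IsCMField.complexConj L • w.1 = w.1)

/-- `θ = cmQuadraticGenerator L` is non-zero in `L⁺_v` (it is a non-square of `L⁺`). [folklore] -/
private theorem algebraMap_cmQuadraticGenerator_ne_zero :
    (algebraMap ↥(maximalRealSubfield L) (v.adicCompletion ↥(maximalRealSubfield L)) ((cmQuadraticGenerator L : 𝓞 ↥(maximalRealSubfield L)) : ↥(maximalRealSubfield L))) ≠ 0 := by
  rw [Ne, map_eq_zero_iff _ (algebraMap ↥(maximalRealSubfield L) (v.adicCompletion ↥(maximalRealSubfield L))).injective]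
  exact fun h => not_isSquare_cmQuadraticGenerator L (by rw [h]; exact IsSquare.zero)

include hw in
/-- **A NORM FROM `L_w` HAS TRIVIAL SYMBOL WITH `θ`**: if `ι_w n = y · σ_w y` (`y ≠ 0`) then `(n, θ)_v = 1`, `θ = cmQuadraticGenerator L` — ★ local norm dictionary
`exists_mul_conjLocal_eq_toLocalRing_iff` (`E_v = L_w` at a non-split place) + ★ `hilbertSymbol_eq_one_iff_mem_quadraticNormSubgroup`. [cite: Omeara1963, §63B, §65A] -/
theorem hilbertSymbol_eq_one_of_toPlace_eq_mul_galAdicCompletionMap {n : v.adicCompletion ↥(maximalRealSubfield L)} {y : w.1.adicCompletion L} (hy : y ≠ 0)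
    (hn : toPlace v w n = y * galAdicCompletionMap (L := L) (IsCMField.complexConj L) hw y) :
    hilbertSymbol (v.adicCompletion ↥(maximalRealSubfield L)) n
      (algebraMap ↥(maximalRealSubfield L) _ ((cmQuadraticGenerator L : 𝓞 ↥(maximalRealSubfield L)) : ↥(maximalRealSubfield L))) = 1 := by
  haveI : CharZero (v.adicCompletion ↥(maximalRealSubfield L)) :=
    charZero_of_injective_algebraMap (algebraMap ↥(maximalRealSubfield L) (v.adicCompletion ↥(maximalRealSubfield L))).injective
  haveI : NeZero (2 : v.adicCompletion ↥(maximalRealSubfield L)) := ⟨two_ne_zero⟩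
  haveI : Subsingleton (PlacesOver L v) := PlacesOver.subsingleton_of_smul_eq (IsCMField.complexConj L) (IsCMField.complexConj_ne_one L) w hw
  have hσy : galAdicCompletionMap (L := L) (IsCMField.complexConj L) hw y ≠ 0 := (map_ne_zero _).2 hy
  have hn0 : n ≠ 0 := fun h0 => by
    rw [h0, map_zero, eq_comm, mul_eq_zero] at hn
    exact hn.elim hy hσy
  have hθ0 := algebraMap_cmQuadraticGenerator_ne_zero L v
  classical
  have hmem : (Units.mk0 n hn0 : (v.adicCompletion ↥(maximalRealSubfield L))ˣ) ∈
      quadraticNormSubgroup (v.adicCompletion ↥(maximalRealSubfield L))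
        (algebraMap ↥(maximalRealSubfield L) _ ((cmQuadraticGenerator L : 𝓞 ↥(maximalRealSubfield L)) : ↥(maximalRealSubfield L))) := by
    rw [← exists_mul_conjLocal_eq_toLocalRing_iff (L := L) v]
    refine ⟨@Pi.single (PlacesOver L v) (fun w' => w'.1.adicCompletion L) _ _ w y, funext fun w' => ?_⟩
    obtain rfl : w' = w := Subsingleton.elim _ _
    rw [Pi.mul_apply, conjLocal_apply_eq_galAdicCompletionMap L v w' hw, toLocalRing_apply, Units.val_mk0, Pi.single_eq_same, hn]
  have h := (hilbertSymbol_eq_one_iff_mem_quadraticNormSubgroup hθ0 (Units.mk0 n hn0)).2 hmem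
  rwa [Units.val_mk0] at h

include hw in
/-- **THE SIGN DICTIONARY**: with `ι bc = ι b·(τ − τ′)·(2 + ι b·ι u₀)∕((1 + ι b τ)(1 + ι b τ′)·η)` (§2), `τ′ = σ_w τ`, `τ + τ′ = ι u₀`, `ι c = (τ − τ′)∕η`, `c₀ := 2c`, and on the
deep locus `|2·ι b·ι u₀|_w < |16|_w`, `1 + ι b τ ≠ 0`: **`(bc·c₀, θ)_v = (b, θ)_v`** — the squares `c²` drop (★ `hilbertSymbol_mul_sq_left`), `(4 + 2 b u₀, θ)_v = 1`
(★ `hilbertSymbol_eq_one_of_valued_toPlace_sub_four_lt`, radius `|16|` — dyadic places included), `((1 + ι b τ)(1 + ι b τ′), θ)_v = 1` (a norm).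
[cite: Labesse2024StabilisationGermesSL2, Th. 0.0.12 (`κ(c₂) = κ(det x̃)κ(b)`)] [cite: LabesseLanglands1979, §2 (2.2)] [cite: Omeara1963, §63B] -/
theorem hilbertSymbol_bcoord_mul_eq_eisenstein {τ η : w.1.adicCompletion L} {b u₀ c c₀ : v.adicCompletion ↥(maximalRealSubfield L)}
    {bc : (v.adicCompletion ↥(maximalRealSubfield L))ˣ} (hb0 : b ≠ 0)
    (hu₀ : τ + galAdicCompletionMap (L := L) (IsCMField.complexConj L) hw τ = toPlace v w u₀)
    (hγ : 1 + toPlace v w b * τ ≠ 0) (hc0 : c ≠ 0) (hc : toPlace v w c = (τ - galAdicCompletionMap (L := L) (IsCMField.complexConj L) hw τ) / η) (hc₀ : c₀ = 2 * c)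
    (hbc : toPlace v w (bc : v.adicCompletion ↥(maximalRealSubfield L)) =
      toPlace v w b * (τ - galAdicCompletionMap (L := L) (IsCMField.complexConj L) hw τ) * (2 + toPlace v w b * toPlace v w u₀) /
        ((1 + toPlace v w b * τ) * (1 + toPlace v w b * galAdicCompletionMap (L := L) (IsCMField.complexConj L) hw τ) * η))
    (hdeep : Valued.v (toPlace v w (2 * b * u₀)) < Valued.v ((4 : w.1.adicCompletion L) * 4)) :
    hilbertSymbol (v.adicCompletion ↥(maximalRealSubfield L)) ((bc : v.adicCompletion ↥(maximalRealSubfield L)) * c₀)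
        (algebraMap ↥(maximalRealSubfield L) _ ((cmQuadraticGenerator L : 𝓞 ↥(maximalRealSubfield L)) : ↥(maximalRealSubfield L))) =
      hilbertSymbol (v.adicCompletion ↥(maximalRealSubfield L)) b
        (algebraMap ↥(maximalRealSubfield L) _ ((cmQuadraticGenerator L : 𝓞 ↥(maximalRealSubfield L)) : ↥(maximalRealSubfield L))) := by
  haveI : CharZero (v.adicCompletion ↥(maximalRealSubfield L)) :=
    charZero_of_injective_algebraMap (algebraMap ↥(maximalRealSubfield L) (v.adicCompletion ↥(maximalRealSubfield L))).injective
  haveI hL : CharZero (w.1.adicCompletion L) := charZero_of_injective_algebraMap (algebraMap L (w.1.adicCompletion L)).injective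
  set σ := galAdicCompletionMap (L := L) (IsCMField.complexConj L) hw with hσdef
  set ι := toPlace v w with hιdef
  set θ : v.adicCompletion ↥(maximalRealSubfield L) :=
    algebraMap ↥(maximalRealSubfield L) _ ((cmQuadraticGenerator L : 𝓞 ↥(maximalRealSubfield L)) : ↥(maximalRealSubfield L)) with hθdef
  have hθ0 : θ ≠ 0 := algebraMap_cmQuadraticGenerator_ne_zero L v
  -- the norm `N = γ σγ` as an element `n ∈ L⁺_v`
  have hσγ : σ (1 + ι b * τ) = 1 + ι b * σ τ := by
    rw [map_add, map_one, map_mul, hσdef, hιdef, galAdicCompletionMap_toPlace_self L v w hw]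
  obtain ⟨n, hn⟩ : ∃ n : v.adicCompletion ↥(maximalRealSubfield L), ι n = (1 + ι b * τ) * (1 + ι b * σ τ) := by
    refine exists_toPlace_eq_of_galAdicCompletionMap_eq (IsCMField.complexConj L) w (IsCMField.complexConj_ne_one L) hw _ ?_
    rw [map_mul, ← hσdef, hσγ, hσdef, map_add, map_one, map_mul, hιdef, galAdicCompletionMap_toPlace_self L v w hw,
      galAdicCompletionMap_galAdicCompletionMap_of_smul_eq (IsCMField.complexConj L) w (IsCMField.complexConj_ne_one L) hw, mul_comm]
  have hn1 : hilbertSymbol (v.adicCompletion ↥(maximalRealSubfield L)) n θ = 1 :=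
    hilbertSymbol_eq_one_of_toPlace_eq_mul_galAdicCompletionMap L v w hw hγ (by rw [← hιdef, hn, ← hσdef, hσγ])
  have hn0 : n ≠ 0 := fun h0 => by
    have : ι n = 0 := by rw [h0, map_zero]
    rw [hn, mul_eq_zero] at this
    rcases this with h1 | h1
    · exact hγ h1
    · rw [← hσγ, map_eq_zero] at h1; exact hγ h1
  -- the window factor `4 + 2 b u₀` has symbol `1`
  have h4 : hilbertSymbol (v.adicCompletion ↥(maximalRealSubfield L)) (2 * (2 + b * u₀)) θ = 1 := by
    refine hilbertSymbol_eq_one_of_valued_toPlace_sub_four_lt ↥(maximalRealSubfield L) L v w ?_ θ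
    have e : toPlace v w (2 * (2 + b * u₀)) - 4 = ι (2 * b * u₀) := by
      rw [← hιdef]; simp only [map_mul, map_add, map_ofNat]; ring
    rw [e]; exact hdeep
  have h2bu : 2 * (2 + b * u₀) ≠ 0 := by
    intro h0
    have h16 : Valued.v (ι (2 * b * u₀)) < Valued.v (4 : w.1.adicCompletion L) := by
      refine lt_of_lt_of_le hdeep ?_
      have h4le : Valued.v (4 : w.1.adicCompletion L) ≤ 1 := by
        have e4 : ((4 : w.1.adicCompletionIntegers L) : w.1.adicCompletion L) = 4 := by norm_cast
        rw [← e4]; exact (4 : w.1.adicCompletionIntegers L).2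
      rw [Valuation.map_mul]
      exact mul_le_of_le_one_right' h4le
    have hval : Valued.v (ι (2 * (2 + b * u₀))) = Valued.v (4 : w.1.adicCompletion L) := by
      rw [show ι (2 * (2 + b * u₀)) = 4 + ι (2 * b * u₀) by simp only [map_mul, map_add, map_ofNat]; ring, Valuation.map_add_eq_of_lt_left _ h16]
    rw [h0, map_zero, Valuation.map_zero] at hval
    exact (by norm_num : (4 : w.1.adicCompletion L) ≠ 0) ((Valuation.zero_iff _).1 hval.symm)
  -- `bc · c₀ = b · c² · (2(2 + b u₀)) · n⁻¹` in `L⁺_v`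
  have hkey : (bc : v.adicCompletion ↥(maximalRealSubfield L)) * c₀ = b * c ^ 2 * (2 * (2 + b * u₀)) * n⁻¹ := by
    apply ι.injective
    have hη0 : η ≠ 0 := by
      intro h0; rw [h0, div_zero] at hc
      exact hc0 ((map_eq_zero ι).1 hc)
    rw [map_mul, hbc, hc₀, map_mul, map_mul, map_mul, map_mul, map_inv₀, map_pow, hn, hc, map_ofNat, map_mul, map_add, map_ofNat, map_mul, ← hu₀]
    field_simp
  rw [hkey, hilbertSymbol_adicCompletion_mul_left ↥(maximalRealSubfield L) v (mul_ne_zero (mul_ne_zero hb0 (pow_ne_zero _ hc0)) h2bu) (inv_ne_zero hn0) hθ0,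
    hilbertSymbol_inv_left hn0, hn1, mul_one,
    hilbertSymbol_adicCompletion_mul_left ↥(maximalRealSubfield L) v (mul_ne_zero hb0 (pow_ne_zero _ hc0)) h2bu hθ0, h4, mul_one,
    hilbertSymbol_mul_sq_left b θ hc0]

end Sign

end Literature.NumberTheory.Rogawski1990

end
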